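import Mathlib.Order.Fin.Basic
import Mathlib.Data.Rat.Cast.Order
import Literature.NumberTheory.LFunctions.JensenHermite
import HarnessLib

/-!
# Box sign certificates for polynomials given as monomial lists

A real polynomial family `x ↦ P(v; x) = Σ_i c_i · Π_k v_k^{e_{ik}} · x^{f_i}` (integer `c_i`) whose
parameter vector `v` is only known to lie in a rational box `B` is hyperbolic for EVERY `v ∈ B` as
soon as `P(·; x)` has certified alternating signs at `d + 1` rational points uniformly over `B`
(`deg ≤ d`). This file supplies that certificate, generically (used by
`JensenXiMomentCertificate.lean` for the renormalised Jensen polynomials of `ξ` in moment form,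
where `v = (δ₁(n), μ₂(n), …, μ₈(n))` and the box is a set of MOMENT ENCLOSURES):

* `Mono`, `polyEvalR` — the polynomial as a list of monomials;
* `ipMul`, `ipPow`, `powProdI`, `Mono.ival`, `polyLower`, `polyUpper` — termwise interval evaluation
  over a box `B : List (ℚ × ℚ)` (Moore product of endpoint pairs) [Moore 1979, Thm. 3.1], with the
  inclusion theorem `polyLower_le_and_le_polyUpper`;
* `PolyCertifies P B d u` — decidable: `u : Fin (d+1) → ℚ` strictly increasing with alternating
  certified signs of `P` over `B`; SOUNDNESS `splits_of_polyCertifies`: any real polynomial `Q` of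
  degree `≤ d` with `c · Q(x) = P(v; x)` for all rational `x`, some `c > 0` and some `v ∈ B`, splits
  over `ℝ` [Szegő §3.3 (5)–(6); tree `exists_roots_of_alternating`, `splits_of_roots`].

What is NOT here: subdivision strategies (a certificate may simply be given per sub-box), and any
statement about `ξ`.

## References
* [Moore1979] R. E. Moore, *Methods and Applications of Interval Analysis*, SIAM 1979, Ch. 3, Thm. 3.1.
* [Szego1939] G. Szegő, *Orthogonal Polynomials*, §3.3 (5)–(6).
-/

open Polynomial Finset

namespace Literature.NumberTheory.LFunctions

/-! ## Interval pairs (endpoints in `ℚ`, values in `ℝ`) -/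

/-- Membership of a real in a rational endpoint pair. [cite: Moore1979, Ch. 3, Thm. 3.1] -/
def IPMem (b : ℚ × ℚ) (v : ℝ) : Prop := ((b.1 : ℚ) : ℝ) ≤ v ∧ v ≤ ((b.2 : ℚ) : ℝ)

/-- Moore product of endpoint pairs. [folklore] -/
def ipMul (a b : ℚ × ℚ) : ℚ × ℚ :=
  (min (min (a.1 * b.1) (a.1 * b.2)) (min (a.2 * b.1) (a.2 * b.2)),
   max (max (a.1 * b.1) (a.1 * b.2)) (max (a.2 * b.1) (a.2 * b.2)))

/-- A product `s * t` with `t ∈ [l, h]` lies between `s*l` and `s*h` (in some order). [folklore] -/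
private theorem mul_mem_of_mem {s t l h : ℝ} (ht : l ≤ t ∧ t ≤ h) :
    min (s * l) (s * h) ≤ s * t ∧ s * t ≤ max (s * l) (s * h) := by
  rcases le_total 0 s with hs | hs
  · exact ⟨(min_le_left _ _).trans (mul_le_mul_of_nonneg_left ht.1 hs),
      (mul_le_mul_of_nonneg_left ht.2 hs).trans (le_max_right _ _)⟩
  · exact ⟨(min_le_right _ _).trans (mul_le_mul_of_nonpos_left ht.2 hs),
      (mul_le_mul_of_nonpos_left ht.1 hs).trans (le_max_left _ _)⟩

/-- **Inclusion property of the Moore product.** [cite: Moore1979, Ch. 3, Thm. 3.1] -/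
theorem ipMem_ipMul {a b : ℚ × ℚ} {u v : ℝ} (hu : IPMem a u) (hv : IPMem b v) :
    IPMem (ipMul a b) (u * v) := by
  obtain ⟨hu1, hu2⟩ := hu
  unfold IPMem ipMul
  push_cast
  -- `u * v` between `min/max (u*b.1) (u*b.2)`, and `u * b.i` between the corner products
  have h1 := mul_mem_of_mem (s := u) hv
  have h2 : ∀ w : ℝ, min ((a.1 : ℝ) * w) ((a.2 : ℝ) * w) ≤ u * w ∧
      u * w ≤ max ((a.1 : ℝ) * w) ((a.2 : ℝ) * w) := by
    intro w
    have := mul_mem_of_mem (s := w) (l := (a.1 : ℝ)) (h := (a.2 : ℝ)) ⟨hu1, hu2⟩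
    simpa only [mul_comm w] using this
  have hb1 := h2 (b.1 : ℝ)
  have hb2 := h2 (b.2 : ℝ)
  constructor
  · -- lower bound
    rcases min_choice (u * (b.1 : ℝ)) (u * (b.2 : ℝ)) with hm | hm
    · have := h1.1; rw [hm] at this
      refine le_trans ?_ this
      refine le_trans ?_ hb1.1
      exact le_min (min_le_of_left_le (min_le_left _ _)) (min_le_of_right_le (min_le_left _ _))
    · have := h1.1; rw [hm] at this
      refine le_trans ?_ this
      refine le_trans ?_ hb2.1
      exact le_min (min_le_of_left_le (min_le_right _ _)) (min_le_of_right_le (min_le_right _ _))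
  · -- upper bound
    rcases max_choice (u * (b.1 : ℝ)) (u * (b.2 : ℝ)) with hm | hm
    · have := h1.2; rw [hm] at this
      refine le_trans this ?_
      refine le_trans hb1.2 ?_
      exact max_le (le_max_of_le_left (le_max_left _ _)) (le_max_of_le_right (le_max_left _ _))
    · have := h1.2; rw [hm] at this
      refine le_trans this ?_
      refine le_trans hb2.2 ?_
      exact max_le (le_max_of_le_left (le_max_right _ _)) (le_max_of_le_right (le_max_right _ _))

/-- Interval power by repeated Moore products. [folklore] -/
def ipPow (a : ℚ × ℚ) : ℕ → ℚ × ℚ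
  | 0 => (1, 1)
  | k + 1 => ipMul (ipPow a k) a

/-- Inclusion property of `ipPow`. [cite: Moore1979, Ch. 3, Thm. 3.1] -/
theorem ipMem_ipPow {a : ℚ × ℚ} {u : ℝ} (hu : IPMem a u) : ∀ k : ℕ, IPMem (ipPow a k) (u ^ k)
  | 0 => by simp [IPMem, ipPow]
  | k + 1 => by
    rw [pow_succ]
    exact ipMem_ipMul (ipMem_ipPow hu k) hu

/-- Interval of `Π_k v_k^{e_k}` over a box (lists; extra entries of either list ignored). [folklore] -/
def powProdI : List (ℚ × ℚ) → List ℕ → ℚ × ℚ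
  | b :: B, k :: e => ipMul (ipPow b k) (powProdI B e)
  | _, _ => (1, 1)

/-- The real product `Π_k v_k^{e_k}` (same truncation convention). [folklore] -/
def powProdR : List ℝ → List ℕ → ℝ
  | v :: V, k :: e => v ^ k * powProdR V e
  | _, _ => 1

/-- A real vector lies in a box (componentwise, equal lengths). [cite: Moore1979, Ch. 3, Thm. 3.1] -/
def BoxMem (B : List (ℚ × ℚ)) (V : List ℝ) : Prop := List.Forall₂ IPMem B V

/-- Inclusion property of `powProdI`. [cite: Moore1979, Ch. 3, Thm. 3.1] -/
theorem ipMem_powProd {B : List (ℚ × ℚ)} {V : List ℝ} (h : BoxMem B V) :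
    ∀ e : List ℕ, IPMem (powProdI B e) (powProdR V e) := by
  induction h with
  | nil => intro e; cases e <;> simp [IPMem, powProdI, powProdR]
  | @cons b v B V hbv _ ih =>
    intro e
    cases e with
    | nil => simp [IPMem, powProdI, powProdR]
    | cons k e => exact ipMem_ipMul (ipMem_ipPow hbv k) (ih e)

/-! ## Monomial lists -/

/-- A monomial `c · Π_k v_k^{e_k} · x^f` with integer coefficient (data for the natural interval
extension of a polynomial). [cite: Moore1979, Ch. 3, Thm. 3.1] -/
structure Mono where
  /-- coefficient -/
  c : ℤ
  /-- exponents of the box variables -/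
  e : List ℕ
  /-- exponent of `x` -/
  f : ℕ

/-- Real value of a monomial at `(V, x)`. [folklore] -/
noncomputable def Mono.evalR (m : Mono) (V : List ℝ) (x : ℝ) : ℝ :=
  (m.c : ℝ) * powProdR V m.e * x ^ m.f

/-- Interval of a monomial over a box at a rational `x`. [folklore] -/
def Mono.ival (m : Mono) (B : List (ℚ × ℚ)) (x : ℚ) : ℚ × ℚ :=
  ipMul ((m.c : ℚ) * x ^ m.f, (m.c : ℚ) * x ^ m.f) (powProdI B m.e)

/-- Inclusion property of `Mono.ival`. [cite: Moore1979, Ch. 3, Thm. 3.1] -/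
theorem Mono.ipMem_ival (m : Mono) {B : List (ℚ × ℚ)} {V : List ℝ} (h : BoxMem B V) (x : ℚ) :
    IPMem (m.ival B x) (m.evalR V x) := by
  have hs : IPMem ((m.c : ℚ) * x ^ m.f, (m.c : ℚ) * x ^ m.f) ((m.c : ℝ) * (x : ℝ) ^ m.f) := by
    constructor <;> push_cast <;> exact le_rfl
  have := ipMem_ipMul hs (ipMem_powProd h m.e)
  rw [Mono.evalR, mul_right_comm]
  exact this

/-- Real value of a monomial list. [folklore] -/
noncomputable def polyEvalR (P : List Mono) (V : List ℝ) (x : ℝ) : ℝ :=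
  (P.map fun m => m.evalR V x).sum

/-- Lower bound of a monomial list over a box at a rational `x`. [folklore] -/
def polyLower (P : List Mono) (B : List (ℚ × ℚ)) (x : ℚ) : ℚ :=
  (P.map fun m => (m.ival B x).1).sum

/-- Upper bound of a monomial list over a box at a rational `x`. [folklore] -/
def polyUpper (P : List Mono) (B : List (ℚ × ℚ)) (x : ℚ) : ℚ :=
  (P.map fun m => (m.ival B x).2).sum

/-- **Inclusion**: `polyLower ≤ P(V; x) ≤ polyUpper` for `V` in the box (termwise interval
arithmetic). [cite: Moore1979, Ch. 3, Thm. 3.1] -/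
theorem polyLower_le_and_le_polyUpper (P : List Mono) {B : List (ℚ × ℚ)} {V : List ℝ}
    (h : BoxMem B V) (x : ℚ) :
    ((polyLower P B x : ℚ) : ℝ) ≤ polyEvalR P V x ∧ polyEvalR P V x ≤ ((polyUpper P B x : ℚ) : ℝ) := by
  induction P with
  | nil => simp [polyLower, polyUpper, polyEvalR]
  | cons m P ih =>
    have hm := m.ipMem_ival h x
    simp only [polyLower, polyUpper, polyEvalR, List.map_cons, List.sum_cons, Rat.cast_add] at ih ⊢
    exact ⟨add_le_add hm.1 ih.1, add_le_add hm.2 ih.2⟩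

/-- Certified sign of `P(·; x)` over the box: `1`, `-1`, or `0` (undecided). [folklore] -/
def polySignAt (P : List Mono) (B : List (ℚ × ℚ)) (x : ℚ) : ℤ :=
  if 0 < polyLower P B x then 1 else if polyUpper P B x < 0 then -1 else 0

/-- **Box sign certificate**: `d + 1` strictly increasing rational points at which the certified
signs of `P` over the box alternate. Decidable. [cite: Szego1939, §3.3 (5)–(6)] -/
def PolyCertifies (P : List Mono) (B : List (ℚ × ℚ)) (d : ℕ) (u : Fin (d + 1) → ℚ) : Prop :=
  (∀ i : Fin d, u i.castSucc < u i.succ) ∧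
    ∀ i : Fin d, polySignAt P B (u i.castSucc) * polySignAt P B (u i.succ) = -1

/-- `PolyCertifies` is decidable (rational arithmetic). [folklore] -/
instance (P : List Mono) (B : List (ℚ × ℚ)) (d : ℕ) (u : Fin (d + 1) → ℚ) :
    Decidable (PolyCertifies P B d u) := by
  unfold PolyCertifies; infer_instance

/-! ## Soundness of the box sign certificate -/

section Soundness

variable {P : List Mono} {B : List (ℚ × ℚ)} {V : List ℝ} {Q : ℝ[X]} {c : ℝ}

/-- Opposite certified signs give a sign change of any `Q` with `c · Q(x) = P(V; x)`, `c > 0`,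
`V` in the box. [folklore] -/
private theorem eval_mul_eval_neg_of_polySignAt (h : BoxMem B V) (hc : 0 < c)
    (hQ : ∀ x : ℚ, c * Q.eval (x : ℝ) = polyEvalR P V x) {x y : ℚ}
    (hs : polySignAt P B x * polySignAt P B y = -1) :
    Q.eval (x : ℝ) * Q.eval (y : ℝ) < 0 := by
  have pos : ∀ {z : ℚ}, polySignAt P B z = 1 → 0 < Q.eval (z : ℝ) := by
    intro z hz
    have h1 : 0 < polyLower P B z := by
      by_contra hc'
      unfold polySignAt at hz
      rw [if_neg hc'] at hz
      by_cases h2 : polyUpper P B z < 0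
      · rw [if_pos h2] at hz; omega
      · rw [if_neg h2] at hz; omega
    have := (polyLower_le_and_le_polyUpper P h z).1
    have hcz : 0 < c * Q.eval (z : ℝ) := by
      rw [hQ]; exact lt_of_lt_of_le (by exact_mod_cast h1) this
    exact pos_of_mul_pos_right hcz hc.le
  have neg : ∀ {z : ℚ}, polySignAt P B z = -1 → Q.eval (z : ℝ) < 0 := by
    intro z hz
    have h2 : polyUpper P B z < 0 := by
      by_contra hc'
      unfold polySignAt at hz
      by_cases h1 : 0 < polyLower P B z
      · rw [if_pos h1] at hz; omega
      · rw [if_neg h1, if_neg hc'] at hz; omega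
    have := (polyLower_le_and_le_polyUpper P h z).2
    have hcz : c * Q.eval (z : ℝ) < 0 := by
      rw [hQ]; exact lt_of_le_of_lt this (by exact_mod_cast h2)
    exact neg_of_mul_neg_right hcz hc.le
  have hx : polySignAt P B x = 1 ∨ polySignAt P B x = -1 ∨ polySignAt P B x = 0 := by
    unfold polySignAt; split_ifs <;> simp
  have hy : polySignAt P B y = 1 ∨ polySignAt P B y = -1 ∨ polySignAt P B y = 0 := by
    unfold polySignAt; split_ifs <;> simp
  rcases hx with hx | hx | hx <;> rcases hy with hy | hy | hy <;> rw [hx, hy] at hs <;> norm_num at hs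
  · exact mul_neg_of_pos_of_neg (pos hx) (neg hy)
  · exact mul_neg_of_neg_of_pos (neg hx) (pos hy)

/-- **Soundness of the box sign certificate**: if `P` is certified on the box `B` at degree `d`,
then every real polynomial `Q` of degree `≤ d` which is a positive multiple of `P(V; ·)` for some
`V ∈ B` splits over `ℝ` (`d` strict sign changes ⇒ `d` distinct real roots).
[cite: Szego1939, §3.3 (5)–(6)] -/
theorem splits_of_polyCertifies {d : ℕ} {u : Fin (d + 1) → ℚ} (hcert : PolyCertifies P B d u)
    (h : BoxMem B V) (hc : 0 < c) (hdeg : Q.natDegree ≤ d)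
    (hQ : ∀ x : ℚ, c * Q.eval (x : ℝ) = polyEvalR P V x) : Q.Splits := by
  obtain ⟨hmono, halt⟩ := hcert
  rcases Nat.eq_zero_or_pos d with rfl | hd
  · rw [eq_C_of_natDegree_le_zero hdeg]; exact Splits.C _
  · have hu : StrictMono (fun i : Fin (d + 1) => ((u i : ℚ) : ℝ)) :=
      Fin.strictMono_iff_lt_succ.2 fun i => by exact_mod_cast hmono i
    have halt' : ∀ i : Fin d,
        Q.eval (((u i.castSucc : ℚ)) : ℝ) * Q.eval (((u i.succ : ℚ)) : ℝ) < 0 :=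
      fun i => eval_mul_eval_neg_of_polySignAt h hc hQ (halt i)
    obtain ⟨t, ht, -, hroot⟩ :=
      exists_roots_of_alternating Q (fun i : Fin (d + 1) => ((u i : ℚ) : ℝ)) hu halt'
    have hQ0 : Q ≠ 0 := by
      intro h0
      have := halt' ⟨0, hd⟩
      rw [h0] at this
      simp at this
    exact (splits_of_roots hQ0 hdeg t ht.injective hroot).1

end Soundness

end Literature.NumberTheory.LFunctions
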